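import Summits.Ventures.HSemireg.WedgeHankelRecurrenceGaussStieltjesPolynomial

/-!
# Venture HSemireg — **THE SHARP UNIFORM ENCLOSURE OF THE ZEROS BY A CHEBYSHEV RECURRENCE**: for a positive recurrence with `α' ≤ a_i ≤ α` (`i ≤ t`) and `b_j ≤ β` (`1 ≤ j ≤ t`), every zero
# `x_0 < ⋯ < x_t` of `q_{t+1}` satisfies **`α' − 2√β cos(π∕(t+2)) ≤ x_0`** and **`x_t ≤ α + 2√β cos(π∕(t+2))`** — attained by the constant recurrence `(α, β)`, whose zeros are the rescaled
# Chebyshev nodes of the second kind `α + 2√β cos(kπ∕(t+2))`; this refines N329's Gershgorin bound `α + 2√β` and N372's strict Wall bound by the factor `cos(π∕(t+2))`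

HONEST FRAMING. Part of the Lean index of the computation cell `pub-hsemireg` (seat p10 gen 46, Sunday typer «UNIFORM-IN-n»).  Real polynomials, `Real.sqrt`, `Real.cos` only; no variety, no cohomology
theory, no sheaf, no Ext group and no semiregularity map is constructed here; nothing here says that HC / HC_CM / HC_AV holds; no Literature fact (unproved `Prop`) is declared or used.  Custodian
versions as in `WedgeHankelSiegelIdeal` (1/3).
SOURCES (cited).  M. E. H. Ismail, X. Li, *Bound on the extreme zeros of orthogonal polynomials*, Proc. Amer. Math. Soc. 115 (1992) 131–140, Thm 2 ∕ 3 (bounds for the extreme zeros from the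
recurrence coefficients via chain sequences); T. S. Chihara, *An Introduction to Orthogonal Polynomials* (1978), Ch. IV §2–3, Ex. 2.4; G. Szegő, *Orthogonal Polynomials*, §6.2 (monotonicity
arguments), (1.12.3); W. Van Assche, *Asymptotics for Orthogonal Polynomials*, LNM 1265 (1987), §1.2 (cf.).
PROOF TYPED HERE.  Monotonicity in two steps — N323 `zeros_mono_diagonal` (`a ≤ α` entrywise, same `b`) then N325 `top_zero_mono_offdiag` (`b ≤ β`, same constant diagonal) — to the constant
recurrence `(α, β)`, which is the Chebyshev-`U` recurrence `(0, 1∕4)` (N360 `chebyshevU_recurrence_eq_prod`) rescaled by `c = 2√β` (N324 `recurrence_scale_spec`) and translated by `α` (N324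
`recurrence_translate_spec`): its top zero is `α + 2√β cos(π∕(t+2))`.  The lower bound by N325 `bottom_zero_anti_offdiag` and `cos((t+1)π∕(t+2)) = −cos(π∕(t+2))`.
DEDUP DISCLOSURE (`rg -n 'cos \\(π /|zeros_le_gershgorin|wall_quarter' Summits/Ventures/HSemireg`, 2026-09-03): N329 (`x ≤ max (a_i + c_i + c_{i+1})`), N372 (`< α + 2√β`), N360 (the `U` nodes themselves);
the `cos(π∕(t+2))`-sharp enclosure is new.  The 3 names below: 0 hits tree-wide.

WHAT IS IN THE TREE.  N323 `zeros_mono_diagonal`; N325 `top_zero_mono_offdiag`, `bottom_zero_anti_offdiag`; N360 `chebyshevU_recurrence_eq_prod`, `chebyshevU_nodes_strictMono`,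
`recurrence_of_coefficients`; N324 `recurrence_scale_spec`, `recurrence_translate_spec`; N279 `recurrence_zeros_interlace`.
THIS FILE (namespace `Summit.Ventures.HSemireg.Wedge.HankelOuter` continued; CHAINED on N378 (import only); 0 definitions):
* §1144 `constant_recurrence_zeros` (the zeros of the constant recurrence `(α, β)`: `α + 2√β cos((t+1−k)π∕(t+2))`, increasing), **`top_zero_le_uniform_cos`**, **`bottom_zero_ge_uniform_cos`**.
CAVEATS.  Extreme zeros only (the interior zeros are NOT monotone in the couplings, N348); equality case not characterised.  Nothing Ext-side.  New names only.
-/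

open Module Polynomial Real
open scoped Matrix Polynomial

namespace Summit.Ventures.HSemireg.Wedge.HankelOuter

/-! ## §1144. Uniform enclosure of the zeros by Chebyshev nodes -/

/-- **THE CONSTANT RECURRENCE `(α, β)`**: `Q_n := (c^n · u_n(c⁻¹ X)) ∘ (X − α)` with `c = 2√β` and `u` the Chebyshev-`U` recurrence `(0, 1∕4)` solves the chapter's recurrence with `a ≡ c·0 + α`,
`b ≡ c²·(1∕4)` (`= β`), and `Q_{t+1} = ∏_k (X − (c cos((t+1−k)π∕(t+2)) + α))` with increasing nodes. [Szegő (1.12.3); N360; this file, §1144] -/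
theorem constant_recurrence_zeros {β : ℝ} (hβ : 0 < β) (α : ℝ) (t : ℕ) :
    ∃ (Q : ℕ → ℝ[X]), Q 0 = 1 ∧ Q 1 = Polynomial.X - C (2 * Real.sqrt β * 0 + α) ∧
      (∀ n, Q (n + 2) = (Polynomial.X - C (2 * Real.sqrt β * 0 + α)) * Q (n + 1) - C ((2 * Real.sqrt β) ^ 2 * (1 / 4)) * Q n) ∧
      StrictMono (fun k : Fin (t + 1) => 2 * Real.sqrt β * cos ((((Fin.rev k : Fin (t + 1)) : ℝ) + 1) * π / ((t : ℝ) + 2)) + α) ∧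
      Q (t + 1) = ∏ k : Fin (t + 1), (Polynomial.X - C (2 * Real.sqrt β * cos ((((Fin.rev k : Fin (t + 1)) : ℝ) + 1) * π / ((t : ℝ) + 2)) + α)) := by
  obtain ⟨u, hu0, hu1, hurec⟩ := recurrence_of_coefficients (fun _ => (0 : ℝ)) (fun _ => (1 / 4 : ℝ))
  have hc : (2 * Real.sqrt β) ≠ 0 := by positivity
  have hcpos : 0 < 2 * Real.sqrt β := by positivity
  obtain ⟨s0, s1, srec, sprod⟩ := recurrence_scale_spec (q := u) (a := fun _ => (0 : ℝ)) (b := fun _ => (1 / 4 : ℝ)) hu0 hu1 hurec hc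
  obtain ⟨t0, t1, trec, tprod⟩ := recurrence_translate_spec (q := fun n => C ((2 * Real.sqrt β) ^ n) * (u n).comp (C (2 * Real.sqrt β)⁻¹ * Polynomial.X))
    (a := fun _ => 2 * Real.sqrt β * 0) (b := fun _ => (2 * Real.sqrt β) ^ 2 * (1 / 4)) s0 s1 srec α
  have hU := chebyshevU_recurrence_eq_prod (q := u) (a := fun _ => (0 : ℝ)) (b := fun _ => (1 / 4 : ℝ)) hu0 hu1 hurec (fun _ => rfl) (fun _ => rfl) t
  refine ⟨fun n => (C ((2 * Real.sqrt β) ^ n) * (u n).comp (C (2 * Real.sqrt β)⁻¹ * Polynomial.X)).comp (Polynomial.X - C α), t0, t1, trec, ?_, tprod (sprod hU)⟩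
  exact ((chebyshevU_nodes_strictMono t).const_mul hcpos).add_const α

/-- **SHARP UNIFORM UPPER BOUND: `x_t ≤ α + 2√β · cos(π∕(t+2))`** for the largest zero of `q_{t+1}` of a positive recurrence with `a_i ≤ α` (`i ≤ t`) and `b_j ≤ β` (`1 ≤ j ≤ t`). [Ismail–Li 1992;
Chihara IV Ex. 2.4; this file, §1144] -/
theorem top_zero_le_uniform_cos {q : ℕ → ℝ[X]} {a b : ℕ → ℝ} (hq0 : q 0 = 1) (hq1 : q 1 = Polynomial.X - C (a 0))
    (hrec : ∀ n, q (n + 2) = (Polynomial.X - C (a (n + 1))) * q (n + 1) - C (b (n + 1)) * q n) (hb : ∀ j, 0 < b j) {t : ℕ} {α β : ℝ} (hβ : 0 < β)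
    (ha : ∀ i, i ≤ t → a i ≤ α) (hbβ : ∀ j, 1 ≤ j → j ≤ t → b j ≤ β) {x : Fin (t + 1) → ℝ} (hx : StrictMono x) (hxq : q (t + 1) = ∏ j, (Polynomial.X - C (x j))) :
    x (Fin.last t) ≤ α + 2 * Real.sqrt β * cos (π / ((t : ℝ) + 2)) := by
  -- the intermediate recurrence `(α, b)` and the constant one `(α, β)`
  obtain ⟨R, hR0, hR1, hRrec⟩ := recurrence_of_coefficients (fun _ => 2 * Real.sqrt β * 0 + α) b
  obtain ⟨y, -, hy, -, hyq, -, -⟩ := recurrence_zeros_interlace (q := R) (a := fun _ => 2 * Real.sqrt β * 0 + α) (b := b) hR0 hR1 hRrec hb t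
  obtain ⟨Q, hQ0, hQ1, hQrec, hz, hQprod⟩ := constant_recurrence_zeros hβ α t
  have h1 : x (Fin.last t) ≤ y (Fin.last t) :=
    zeros_mono_diagonal (q := q) (q' := R) (a := a) (a' := fun _ => 2 * Real.sqrt β * 0 + α) (b := b) hq0 hq1 hrec hR0 hR1 hRrec hb
      (fun i hi => by show a i ≤ 2 * Real.sqrt β * 0 + α; rw [mul_zero, zero_add]; exact ha i hi) hx hxq hy hyq (Fin.last t)
  have hβ' : ∀ j : ℕ, 0 < (fun _ : ℕ => (2 * Real.sqrt β) ^ 2 * (1 / 4 : ℝ)) j := fun _ => by positivity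
  have hsq : (2 * Real.sqrt β) ^ 2 * (1 / 4 : ℝ) = β := by rw [mul_pow, sq_sqrt hβ.le]; ring
  have h2 := top_zero_mono_offdiag (q := R) (q' := Q) (a := fun _ => 2 * Real.sqrt β * 0 + α) (b := b) (b' := fun _ => (2 * Real.sqrt β) ^ 2 * (1 / 4 : ℝ))
    hR0 hR1 hRrec hQ0 hQ1 hQrec hb hβ' (t := t) (fun j hj1 hj2 => by show b j ≤ (2 * Real.sqrt β) ^ 2 * (1 / 4 : ℝ); rw [hsq]; exact hbβ j hj1 hj2) hy hyq hz hQprod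
  have hlast : 2 * Real.sqrt β * cos ((((Fin.rev (Fin.last t) : Fin (t + 1)) : ℝ) + 1) * π / ((t : ℝ) + 2)) + α = α + 2 * Real.sqrt β * cos (π / ((t : ℝ) + 2)) := by
    rw [Fin.rev_last, Fin.val_zero, Nat.cast_zero, zero_add, one_mul, add_comm]
  linarith [h1, h2, hlast.le, hlast.ge]

/-- **SHARP UNIFORM LOWER BOUND: `α' − 2√β · cos(π∕(t+2)) ≤ x_0`** for the smallest zero when `α' ≤ a_i` (`i ≤ t`) and `b_j ≤ β` (`1 ≤ j ≤ t`). [Ismail–Li 1992; this file, §1144] -/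
theorem bottom_zero_ge_uniform_cos {q : ℕ → ℝ[X]} {a b : ℕ → ℝ} (hq0 : q 0 = 1) (hq1 : q 1 = Polynomial.X - C (a 0))
    (hrec : ∀ n, q (n + 2) = (Polynomial.X - C (a (n + 1))) * q (n + 1) - C (b (n + 1)) * q n) (hb : ∀ j, 0 < b j) {t : ℕ} {α' β : ℝ} (hβ : 0 < β)
    (ha : ∀ i, i ≤ t → α' ≤ a i) (hbβ : ∀ j, 1 ≤ j → j ≤ t → b j ≤ β) {x : Fin (t + 1) → ℝ} (hx : StrictMono x) (hxq : q (t + 1) = ∏ j, (Polynomial.X - C (x j))) :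
    α' - 2 * Real.sqrt β * cos (π / ((t : ℝ) + 2)) ≤ x 0 := by
  obtain ⟨R, hR0, hR1, hRrec⟩ := recurrence_of_coefficients (fun _ => 2 * Real.sqrt β * 0 + α') b
  obtain ⟨y, -, hy, -, hyq, -, -⟩ := recurrence_zeros_interlace (q := R) (a := fun _ => 2 * Real.sqrt β * 0 + α') (b := b) hR0 hR1 hRrec hb t
  obtain ⟨Q, hQ0, hQ1, hQrec, hz, hQprod⟩ := constant_recurrence_zeros hβ α' t
  have h1 : y 0 ≤ x 0 :=
    zeros_mono_diagonal (q := R) (q' := q) (a := fun _ => 2 * Real.sqrt β * 0 + α') (a' := a) (b := b) hR0 hR1 hRrec hq0 hq1 hrec hb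
      (fun i hi => by show 2 * Real.sqrt β * 0 + α' ≤ a i; rw [mul_zero, zero_add]; exact ha i hi) hy hyq hx hxq 0
  have hβ' : ∀ j : ℕ, 0 < (fun _ : ℕ => (2 * Real.sqrt β) ^ 2 * (1 / 4 : ℝ)) j := fun _ => by positivity
  have hsq : (2 * Real.sqrt β) ^ 2 * (1 / 4 : ℝ) = β := by rw [mul_pow, sq_sqrt hβ.le]; ring
  have h2 := bottom_zero_anti_offdiag (q := R) (q' := Q) (a := fun _ => 2 * Real.sqrt β * 0 + α') (b := b) (b' := fun _ => (2 * Real.sqrt β) ^ 2 * (1 / 4 : ℝ))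
    hR0 hR1 hRrec hQ0 hQ1 hQrec hb hβ' (t := t) (fun j hj1 hj2 => by show b j ≤ (2 * Real.sqrt β) ^ 2 * (1 / 4 : ℝ); rw [hsq]; exact hbβ j hj1 hj2) hy hyq hz hQprod
  have hcos : cos ((((Fin.rev (0 : Fin (t + 1)) : Fin (t + 1)) : ℝ) + 1) * π / ((t : ℝ) + 2)) = -cos (π / ((t : ℝ) + 2)) := by
    rw [Fin.rev_zero, Fin.val_last, ← Real.cos_pi_sub]
    congr 1
    field_simp
    ring
  have hfirst : 2 * Real.sqrt β * cos ((((Fin.rev (0 : Fin (t + 1)) : Fin (t + 1)) : ℝ) + 1) * π / ((t : ℝ) + 2)) + α' = α' - 2 * Real.sqrt β * cos (π / ((t : ℝ) + 2)) := by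
    rw [hcos]; ring
  linarith [h1, h2, hfirst.le, hfirst.ge]

end Summit.Ventures.HSemireg.Wedge.HankelOuter
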